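import Literature.MathematicalPhysics.QuantumLattice.XXZThermalSpontaneousOrder
import Literature.MathematicalPhysics.QuantumLattice.HeisenbergOrderEvenTorusLROProofs
import HarnessLib

/-!
# Symmetry breaking in Heisenberg antiferromagnets at `T > 0`, `d ≥ 3` (Koma–Tasaki 1993 BY NAME):
# Néel long-range order forces a spontaneous staggered magnetisation `≥ √3 σ` (Heisenberg, `SU(2)`),
# `≥ √2 σ` (XXZ with XY-like anisotropy, `U(1)`), under every infinitesimal staggered field

T. Koma, H. Tasaki, *Symmetry breaking in Heisenberg antiferromagnets*, Commun. Math. Phys. **158** (1993)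
191–214 [KomaTasaki1993], §1 (1.1)–(1.8), Theorem 2.1, Corollary 2.2 (2.14)–(2.18) ("`m_s ≥ √3 σ`"), and the
Remark after Theorem 6.1 (`SO(2) = U(1)`: factor `√2`, "quantum antiferromagnets with an XY-like
anisotropy").  The abstract theorems are PROVED in the tree (`kt93_theorem_2_1_holds`, `kt93_corollary_2_2_holds`,
`Z2System.kt93_corollary_2_2_u1`) and freed of hypothesis i) in `KomaTasakiGriffithsTheoremSubsequence.lean`
(§3–§5).  The long-range order inputs are the tree's `xxzAF_thermal_planar_x` (`XXZAntiferromagnetThermalOrder.lean`,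
Björnberg–Ueltschi 2022 Thm 3.2 / Dyson–Lieb–Simon 1978 / Kennedy–Lieb–Shastry 1988): for `d ≥ 3`, `S = n/2 ≥ ½`,
`J > 0`, `0 ≤ Δ ≤ 1`, `β ≥ β₀`, STAGGERED long-range order of `Sˣ` in the Gibbs states of
`xxzHamiltonian n (torusGraph d L) J Δ = J Σ_{⟨x,y⟩}(SˣSˣ + SʸSʸ + ΔSᶻSᶻ)` on the even tori.

* §1 (generic graph, PROVED): the `su(2)` relations in vector form — `S^jS^k - S^kS^j = iΣ_l ε_{jkl}S^l` on one
  site (`spinVec_comm`), `[S^j_tot, S^k_x]`, `[S^j_tot, S^k_tot]`, and for the STAGGERED spins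
  `O^{(k)} = Σ_x (-1)^x S^k_x` (`XXZKT.stagSpin`, any sign pattern `(-1)^{σ(x)}`): `[S^j_tot, O^{(k)}] = iΣ_l ε_{jkl}O^{(l)}`
  (KT93 (2.16)) and `[O^{(j)}, O^{(k)}] = iΣ_l ε_{jkl}S^l_tot` (KT93 (7.22): only diagonal terms survive); the
  half turn about the `3`-axis flips `O^{(1)}, O^{(2)}`; at `Δ = 1`, `[H, S^j_tot] = 0` for all `j`.
* §2 (torus `(ℤ/Lℤ)^d`, sign `(-1)^{Σ_i x_i}`): **`XXZKT.afZ2System d L n J Δ`** (KT93 `ℤ₂` system, order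
  `O_Λ = Σ_x(-1)^xSˣ_x`) and **`XXZKT.afSU2System d L n J`** (KT93 `SU(2)` system (2.14)–(2.17) of the Heisenberg
  antiferromagnet `Δ = 1`: `o^{(i)}_x = (-1)^xS^i_x`, `X^{(j)} = S^j_tot`), with dictionaries
  (`moment β 1 = |Λ|⁻²Σ_{x,y}(-1)^x(-1)^y Re⟨Sˣ_xSˣ_y⟩_β`).
* §3 **`heisenbergAF_thermal_spontaneousStaggeredMagnetisation`** (`d ≥ 3`, every spin, `J > 0`, `Δ = 1`):
  there is `β₀ > 0` such that for every `β ≥ β₀` there is `σ > 0` with: for every staggered field `B > 0` and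
  `ε > 0`, eventually on the even tori, **`√3 σ - ε ≤ |Λ|⁻¹ Re⟨O_Λ⟩_{β, H - B·O_Λ}`**, `O_Λ = Σ_x(-1)^xSˣ_x` — KT93
  Corollary 2.2 for its own model (the paper's title), volume limit first, hypothesis i) removed;
  **`xxzAF_thermal_spontaneousStaggeredMagnetisation`** (`0 ≤ Δ ≤ 1`, `U(1)` only): the same with `√2 σ`.

Everything is PROVED; two definitions with body (the two instances), no named fact.  NOT a statement about
the Hubbard model (quantum spins).

## References

* [KomaTasaki1993] T. Koma, H. Tasaki, Commun. Math. Phys. 158 (1993) 191–214, §1, §2 (2.14)–(2.18), Thm 2.1,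
  Cor 2.2, Remark after Thm 6.1, (7.22).
* [DLS1978] F. J. Dyson, E. H. Lieb, B. Simon, J. Stat. Phys. 18 (1978) 335–383, §1–§2.
* [BjornbergUeltschi2022] J. E. Björnberg, D. Ueltschi, J. Math. Phys. 63 (2022), Theorem 3.2.
* [KLS1988JSP] T. Kennedy, E. H. Lieb, B. S. Shastry, J. Stat. Phys. 53 (1988) 1019.
* [Tasaki2020] H. Tasaki, *Physics and Mathematics of Quantum Many-Body Systems*, Springer 2020, §2.1–2.5.
-/

noncomputable section

open Matrix Finset Filter Topology
open scoped ComplexOrder Matrix.Norms.L2Operator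
open Literature.MathematicalPhysics.QuantumLattice Literature.MathematicalPhysics.QuantumLattice.SpinOperators
  Literature.MathematicalPhysics.QuantumLattice.KomaTasaki Literature.Probability.LatticeModels

namespace Literature.MathematicalPhysics.QuantumLattice

namespace XXZKT

/-! ### §1. Generic graph: `su(2)` relations in vector form, staggered spins -/

section Graph

variable {Λ : Type*} [Fintype Λ] [DecidableEq Λ] (n : ℕ)

/-- The Levi-Civita table. [cite: KomaTasaki1993, after (2.15)] -/
private theorem lc_table :
    leviCivita 0 1 2 = 1 ∧ leviCivita 1 2 0 = 1 ∧ leviCivita 2 0 1 = 1 ∧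
    leviCivita 1 0 2 = -1 ∧ leviCivita 2 1 0 = -1 ∧ leviCivita 0 2 1 = -1 ∧
    leviCivita 0 1 0 = 0 ∧ leviCivita 0 1 1 = 0 ∧ leviCivita 1 2 1 = 0 ∧ leviCivita 1 2 2 = 0 ∧
    leviCivita 2 0 2 = 0 ∧ leviCivita 2 0 0 = 0 ∧ leviCivita 1 0 1 = 0 ∧ leviCivita 1 0 0 = 0 ∧
    leviCivita 2 1 2 = 0 ∧ leviCivita 2 1 1 = 0 ∧ leviCivita 0 2 0 = 0 ∧ leviCivita 0 2 2 = 0 ∧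
    leviCivita 0 0 0 = 0 ∧ leviCivita 0 0 1 = 0 ∧ leviCivita 0 0 2 = 0 ∧
    leviCivita 1 1 0 = 0 ∧ leviCivita 1 1 1 = 0 ∧ leviCivita 1 1 2 = 0 ∧
    leviCivita 2 2 0 = 0 ∧ leviCivita 2 2 1 = 0 ∧ leviCivita 2 2 2 = 0 := by
  decide

/-- **`S^jS^k - S^kS^j = i Σ_l ε_{jkl} S^l`** on one site (the three commutation relations and their
consequences, in vector form). [cite: Tasaki2020, §2.1 eq. (2.1.1)] [cite: KomaTasaki1993, (2.15)] -/
theorem spinVec_comm (j k : Fin 3) :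
    spinVec n j * spinVec n k - spinVec n k * spinVec n j =
      Complex.I • ∑ l, (leviCivita j k l : ℂ) • spinVec n l := by
  have hxy : spinX n * spinY n - spinY n * spinX n = Complex.I • SpinOperators.spinZ n := by
    have h := lie_spinX_spinY n; rwa [Ring.lie_def] at h
  have hyz : spinY n * SpinOperators.spinZ n - SpinOperators.spinZ n * spinY n = Complex.I • spinX n := by
    have h := lie_spinY_spinZ n; rwa [Ring.lie_def] at h
  have hzx : SpinOperators.spinZ n * spinX n - spinX n * SpinOperators.spinZ n = Complex.I • spinY n := by
    have h := lie_spinZ_spinX n; rwa [Ring.lie_def] at h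
  obtain ⟨e012, e120, e201, e102, e210, e021, e010, e011, e121, e122, e202, e200, e101, e100, e212, e211, e020,
    e022, e000, e001, e002, e110, e111, e112, e220, e221, e222⟩ := lc_table
  fin_cases j <;> fin_cases k <;>
    simp only [Fin.zero_eta, Fin.mk_one, Fin.reduceFinMk, Fin.isValue, Fin.sum_univ_three, spinVec_zero,
      spinVec_one, spinVec_two, e012, e120, e201, e102, e210, e021, e010, e011, e121, e122, e202, e200, e101,
      e100, e212, e211, e020, e022, e000, e001, e002, e110, e111, e112, e220, e221, e222, Int.cast_zero,
      Int.cast_one, Int.cast_neg, zero_smul, one_smul, neg_smul, add_zero, zero_add, smul_zero, smul_neg,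
      sub_self]
  · exact hxy
  · rw [← neg_sub, hzx]
  · rw [← neg_sub, hxy]
  · exact hyz
  · exact hzx
  · rw [← neg_sub, hyz]

/-- `S^j_xS^k_x - S^k_xS^j_x = i Σ_l ε_{jkl} S^l_x` (same site). [cite: Tasaki2020, §2.2 eq. (2.2.6)] -/
theorem siteSpin_comm_same (x : Λ) (j k : Fin 3) :
    (siteSpin n x j * siteSpin n x k - siteSpin n x k * siteSpin n x j : Op Λ (n + 1)) =
      Complex.I • ∑ l, (leviCivita j k l : ℂ) • siteSpin n x l := by
  show _ = Complex.I • ∑ l, (leviCivita j k l : ℂ) • (onSite x (spinVec n l) : Op Λ (n + 1))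
  rw [siteSpin, siteSpin, onSite_mul, onSite_mul, ← onSite_sub', spinVec_comm, onSite_smul', onSite_sum]
  simp only [onSite_smul']

/-- **`[S^j_tot, S^k_x] = i Σ_l ε_{jkl} S^l_x`.** [cite: Tasaki2020, §2.2 eqs. (2.2.6), (2.2.11)] -/
theorem totalSpin_comm_siteSpin (x : Λ) (j k : Fin 3) :
    (totalSpin n j * siteSpin n x k - siteSpin n x k * totalSpin n j : Op Λ (n + 1)) =
      Complex.I • ∑ l, (leviCivita j k l : ℂ) • siteSpin n x l := by
  show _ = Complex.I • ∑ l, (leviCivita j k l : ℂ) • (onSite x (spinVec n l) : Op Λ (n + 1))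
  have h := siteSpin_mul_totalSpin_sub n x k j
  rw [Ring.lie_def] at h
  rw [← neg_sub, h, ← onSite_neg', neg_sub, spinVec_comm, onSite_smul', onSite_sum]
  simp only [onSite_smul']

/-- **`[S^j_tot, S^k_tot] = i Σ_l ε_{jkl} S^l_tot`** — KT93 (2.15) for `X^{(j)} = S^j_tot`.
[cite: KomaTasaki1993, (2.15)] [cite: Tasaki2020, §2.2 eq. (2.2.11)] -/
theorem totalSpin_comm_totalSpin (j k : Fin 3) :
    (totalSpin n j * totalSpin n k - totalSpin n k * totalSpin n j : Op Λ (n + 1)) =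
      Complex.I • ∑ l, (leviCivita j k l : ℂ) • totalSpin n l := by
  have ek : (totalSpin n k : Op Λ (n + 1)) = ∑ x, siteSpin n x k := rfl
  calc (totalSpin n j * totalSpin n k - totalSpin n k * totalSpin n j : Op Λ (n + 1))
      = ∑ x, (totalSpin n j * siteSpin n x k - siteSpin n x k * totalSpin n j) := by
        rw [ek, Finset.mul_sum, Finset.sum_mul, ← Finset.sum_sub_distrib]
    _ = ∑ x, Complex.I • ∑ l, (leviCivita j k l : ℂ) • (siteSpin n x l : Op Λ (n + 1)) :=
        Finset.sum_congr rfl fun x _ => totalSpin_comm_siteSpin n x j k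
    _ = Complex.I • ∑ l, (leviCivita j k l : ℂ) • totalSpin n l := by
        rw [← Finset.smul_sum, Finset.sum_comm]
        simp only [totalSpin, Finset.smul_sum]

/-! #### Staggered spins -/

variable (σ : Λ → ℕ)

/-- The sign `(-1)^{σ(x)}` of a site (on the even torus, `σ(x) = Σ_i x_i`). [cite: KomaTasaki1993, §1 (1.2)] -/
def stagSign (x : Λ) : ℝ := (-1) ^ σ x

omit [Fintype Λ] [DecidableEq Λ] in
/-- `(-1)^σ · (-1)^σ = 1`. [cite: KomaTasaki1993, §1 (1.2)] -/
theorem stagSign_mul_self (x : Λ) : stagSign σ x * stagSign σ x = 1 := by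
  rw [stagSign, ← pow_add, ← two_mul, pow_mul, neg_one_sq, one_pow]

omit [Fintype Λ] [DecidableEq Λ] in
/-- `|(-1)^σ| = 1`. [cite: KomaTasaki1993, §1 (1.2)] -/
theorem abs_stagSign (x : Λ) : |stagSign σ x| = 1 := by
  rw [stagSign, abs_pow, abs_neg, abs_one, one_pow]

/-- **The staggered spin** `O^{(α)} = Σ_x (-1)^{σ(x)} S^α_x` (KT93 (1.2), (2.14) with `o^{(α)}_x = (-1)^xS^α_x`).
[cite: KomaTasaki1993, §1 (1.2), §2 (2.14)] -/
def stagSpin (α : Fin 3) : Op Λ (n + 1) := ∑ x, (stagSign σ x : ℂ) • siteSpin n x α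

/-- `(-1)^x S^α_x` is Hermitian. [cite: KomaTasaki1993, §2 (o_x self-adjoint)] -/
theorem isHermitian_stagSign_smul_siteSpin (x : Λ) (α : Fin 3) :
    ((stagSign σ x : ℂ) • siteSpin n x α : Op Λ (n + 1)).IsHermitian :=
  (siteSpin_isHermitian n x α).smul (by rw [isSelfAdjoint_iff, Complex.star_def, Complex.conj_ofReal])

/-- `O^{(α)}` is Hermitian. [cite: KomaTasaki1993, §2 (2.14)] -/
theorem isHermitian_stagSpin (α : Fin 3) : (stagSpin n σ α).IsHermitian :=
  (isSelfAdjoint_sum Finset.univ fun x _ => (isHermitian_stagSign_smul_siteSpin n σ x α).isSelfAdjoint).isHermitian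

/-- `‖(-1)^x S^α_x‖ ≤ s`. [cite: KomaTasaki1993, §2 ii)] -/
theorem norm_stagSign_smul_siteSpin_le (x : Λ) (α : Fin 3) :
    ‖((stagSign σ x : ℂ) • siteSpin n x α : Op Λ (n + 1))‖ ≤ sNorm n := by
  rw [norm_smul, Complex.norm_real, Real.norm_eq_abs, abs_stagSign, one_mul]
  exact norm_siteSpin_le_sNorm n x α

/-- `‖O^{(α)}‖ ≤ s|Λ|`. [cite: KomaTasaki1993, §2 ii)] -/
theorem norm_stagSpin_le (α : Fin 3) : ‖stagSpin n σ α‖ ≤ sNorm n * Fintype.card Λ :=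
  calc ‖stagSpin n σ α‖ ≤ ∑ x : Λ, ‖((stagSign σ x : ℂ) • siteSpin n x α : Op Λ (n + 1))‖ := norm_sum_le _ _
    _ ≤ ∑ _x : Λ, sNorm n := Finset.sum_le_sum fun x _ => norm_stagSign_smul_siteSpin_le n σ x α
    _ = sNorm n * Fintype.card Λ := by rw [Finset.sum_const, Finset.card_univ, nsmul_eq_mul, mul_comm]

/-- The half turn flips `O^{(1)} = Σ(-1)^xSˣ_x`: `U O^{(1)} Uᴴ = -O^{(1)}` (KT93 (2.5)). [cite: KomaTasaki1993, §2 (2.5)] -/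
theorem halfTurn_conj_stagSpin_zero :
    halfTurn n * stagSpin n σ 0 * (halfTurn n)ᴴ = -(stagSpin n σ 0 : Op Λ (n + 1)) := by
  rw [stagSpin, Finset.mul_sum, Finset.sum_mul, ← Finset.sum_neg_distrib]
  refine Finset.sum_congr rfl fun x _ => ?_
  rw [Matrix.mul_smul, Matrix.smul_mul, halfTurn_conj_siteSpin_zero, smul_neg]

/-- The half turn flips `O^{(2)} = Σ(-1)^xSʸ_x`. [cite: KomaTasaki1993, §2 (2.5)] -/
theorem halfTurn_conj_stagSpin_one :
    halfTurn n * stagSpin n σ 1 * (halfTurn n)ᴴ = -(stagSpin n σ 1 : Op Λ (n + 1)) := by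
  rw [stagSpin, Finset.mul_sum, Finset.sum_mul, ← Finset.sum_neg_distrib]
  refine Finset.sum_congr rfl fun x _ => ?_
  rw [Matrix.mul_smul, Matrix.smul_mul, halfTurn_conj_siteSpin_one, smul_neg]

/-- **KT93 v) (2.16) for the staggered spins: `[S^j_tot, O^{(k)}] = i Σ_l ε_{jkl} O^{(l)}`** (the rotation
generators act sitewise, the signs factor out). [cite: KomaTasaki1993, (2.16)] -/
theorem totalSpin_comm_stagSpin (j k : Fin 3) :
    (totalSpin n j * stagSpin n σ k - stagSpin n σ k * totalSpin n j : Op Λ (n + 1)) =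
      Complex.I • ∑ l, (leviCivita j k l : ℂ) • stagSpin n σ l := by
  calc (totalSpin n j * stagSpin n σ k - stagSpin n σ k * totalSpin n j : Op Λ (n + 1))
      = ∑ x, (stagSign σ x : ℂ) • (totalSpin n j * siteSpin n x k - siteSpin n x k * totalSpin n j) := by
        rw [stagSpin, Finset.mul_sum, Finset.sum_mul, ← Finset.sum_sub_distrib]
        refine Finset.sum_congr rfl fun x _ => ?_
        rw [Matrix.mul_smul, Matrix.smul_mul, smul_sub]
    _ = ∑ x, (stagSign σ x : ℂ) • (Complex.I • ∑ l, (leviCivita j k l : ℂ) • (siteSpin n x l : Op Λ (n + 1))) :=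
        Finset.sum_congr rfl fun x _ => by rw [totalSpin_comm_siteSpin]
    _ = Complex.I • ∑ l, (leviCivita j k l : ℂ) • stagSpin n σ l := by
        simp only [stagSpin, Finset.smul_sum, smul_smul]
        rw [Finset.sum_comm]
        refine Finset.sum_congr rfl fun l _ => Finset.sum_congr rfl fun x _ => ?_
        congr 1
        ring

/-- `[S^j_x, O^{(k)}] = (-1)^x i Σ_l ε_{jkl} S^l_x` (only the site `x` contributes, iv)). [cite: KomaTasaki1993, §2 iv), (7.22)] -/
theorem siteSpin_comm_stagSpin (x : Λ) (j k : Fin 3) :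
    (siteSpin n x j * stagSpin n σ k - stagSpin n σ k * siteSpin n x j : Op Λ (n + 1)) =
      (stagSign σ x : ℂ) • (Complex.I • ∑ l, (leviCivita j k l : ℂ) • siteSpin n x l) := by
  rw [stagSpin, Finset.mul_sum, Finset.sum_mul, ← Finset.sum_sub_distrib, Finset.sum_eq_single x]
  · rw [Matrix.mul_smul, Matrix.smul_mul, ← smul_sub, siteSpin_comm_same]
  · intro y _ hyx
    rw [Matrix.mul_smul, Matrix.smul_mul, ← smul_sub, (siteSpin_commute_of_ne_holds n (Ne.symm hyx) j k).eq,
      sub_self, smul_zero]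
  · intro hx
    exact absurd (Finset.mem_univ x) hx

/-- **KT93 (7.22) for the staggered spins: `[O^{(j)}, O^{(k)}] = i Σ_l ε_{jkl} S^l_tot`** (off-diagonal sites
commute, `(-1)^x(-1)^x = 1`). [cite: KomaTasaki1993, (7.22)] -/
theorem stagSpin_comm_stagSpin (j k : Fin 3) :
    (stagSpin n σ j * stagSpin n σ k - stagSpin n σ k * stagSpin n σ j : Op Λ (n + 1)) =
      Complex.I • ∑ l, (leviCivita j k l : ℂ) • totalSpin n l := by
  have ej : (stagSpin n σ j : Op Λ (n + 1)) = ∑ x, (stagSign σ x : ℂ) • siteSpin n x j := rfl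
  calc (stagSpin n σ j * stagSpin n σ k - stagSpin n σ k * stagSpin n σ j : Op Λ (n + 1))
      = ∑ x, (stagSign σ x : ℂ) • (siteSpin n x j * stagSpin n σ k - stagSpin n σ k * siteSpin n x j) := by
        rw [ej, Finset.sum_mul, Finset.mul_sum, ← Finset.sum_sub_distrib]
        refine Finset.sum_congr rfl fun x _ => ?_
        rw [Matrix.smul_mul, Matrix.mul_smul, smul_sub]
    _ = ∑ x, Complex.I • ∑ l, (leviCivita j k l : ℂ) • (siteSpin n x l : Op Λ (n + 1)) := by
        refine Finset.sum_congr rfl fun x _ => ?_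
        rw [siteSpin_comm_stagSpin, smul_smul, ← Complex.ofReal_mul, stagSign_mul_self, Complex.ofReal_one, one_smul]
    _ = Complex.I • ∑ l, (leviCivita j k l : ℂ) • totalSpin n l := by
        rw [← Finset.smul_sum, Finset.sum_comm]
        simp only [totalSpin, Finset.smul_sum]

/-! #### The three relations used below, spelled out -/

/-- `[Sᶻ_tot, O^{(2)}] = -i O^{(1)}`. [cite: KomaTasaki1993, (2.16)] -/
theorem totalSpin_two_comm_stagSpin_one :
    (totalSpin n 2 * stagSpin n σ 1 - stagSpin n σ 1 * totalSpin n 2 : Op Λ (n + 1)) =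
      (-Complex.I) • stagSpin n σ 0 := by
  obtain ⟨-, -, -, -, e210, -, -, -, -, -, -, -, -, -, e212, e211, -⟩ := lc_table
  rw [totalSpin_comm_stagSpin]
  simp only [Fin.sum_univ_three, e210, e211, e212, Int.cast_zero, Int.cast_one, Int.cast_neg, zero_smul,
    neg_smul, one_smul, add_zero, smul_neg, neg_smul]

/-- `[Sᶻ_tot, O^{(1)}] = i O^{(2)} = -((-i) O^{(2)})`. [cite: KomaTasaki1993, (2.16)] -/
theorem totalSpin_two_comm_stagSpin_zero :
    (totalSpin n 2 * stagSpin n σ 0 - stagSpin n σ 0 * totalSpin n 2 : Op Λ (n + 1)) =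
      -((-Complex.I) • stagSpin n σ 1) := by
  obtain ⟨-, -, e201, -, -, -, -, -, -, -, e202, e200, -⟩ := lc_table
  rw [totalSpin_comm_stagSpin]
  simp only [Fin.sum_univ_three, e200, e201, e202, Int.cast_zero, Int.cast_one, zero_smul, one_smul,
    add_zero, zero_add, neg_smul, neg_neg]

/-- `[O^{(2)}, O^{(1)}] = -i Sᶻ_tot`, hence `‖[O^{(2)}, O^{(1)}]‖ ≤ 1·s²·|Λ|`. [cite: KomaTasaki1993, (7.22)] -/
theorem norm_stagSpin_one_comm_stagSpin_zero_le :
    ‖(stagSpin n σ 1 * stagSpin n σ 0 - stagSpin n σ 0 * stagSpin n σ 1 : Op Λ (n + 1))‖ ≤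
      1 * sNorm n ^ 2 * Fintype.card Λ := by
  obtain ⟨-, -, -, e102, -, -, -, -, -, -, -, -, e101, e100, -⟩ := lc_table
  rw [stagSpin_comm_stagSpin]
  simp only [Fin.sum_univ_three, e100, e101, e102, Int.cast_zero, Int.cast_one, Int.cast_neg, zero_smul,
    neg_smul, one_smul, zero_add, smul_neg, norm_neg, norm_smul, Complex.norm_I, one_mul]
  refine (norm_totalSpin_le n 2).trans ?_
  have hs := one_le_sNorm n
  have hN : (0 : ℝ) ≤ Fintype.card Λ := Nat.cast_nonneg _
  nlinarith [mul_nonneg (sub_nonneg.2 hs) (mul_nonneg (zero_le_one.trans hs) hN)]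

/-- LOCALITY: `h_x` commutes with `(-1)^y S^β_y` off the closed neighbourhood of `x`. [cite: KomaTasaki1993, §2 iii)] -/
theorem commute_localHam_stagSign_smul_siteSpin (G : SimpleGraph Λ) [DecidableRel G.Adj] (J Δ : ℝ) {x y : Λ}
    (hyx : y ≠ x) (hadj : ¬ G.Adj x y) (β : Fin 3) :
    Commute (localHam n G J Δ x) ((stagSign σ y : ℂ) • siteSpin n y β) :=
  (commute_localHam_siteSpin n G J Δ hyx hadj β).smul_right _

/-- iv): `(-1)^xS^i_x` and `(-1)^yS^{i'}_y` commute for `x ≠ y`. [cite: KomaTasaki1993, §2 iv)] -/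
theorem commute_stagSign_smul_siteSpin {x y : Λ} (hxy : x ≠ y) (i i' : Fin 3) :
    Commute ((stagSign σ x : ℂ) • siteSpin n x i : Op Λ (n + 1)) ((stagSign σ y : ℂ) • siteSpin n y i') :=
  ((siteSpin_commute_of_ne_holds n hxy i i').smul_left _).smul_right _

/-! #### The isotropic point: `SU(2)` invariance -/

/-- `xxzHamiltonian n G J 1 = heisenbergHamiltonian n G J` (each edge term is `𝐒_x·𝐒_y`).
[cite: Tasaki2020, §2.4 (remarks after eq. (2.4.1))] -/
private theorem xxzHamiltonian_one_eq_heisenberg (G : SimpleGraph Λ) [DecidableRel G.Adj] (J : ℝ) :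
    xxzHamiltonian n G J 1 = heisenbergHamiltonian n G J := by
  rw [xxzHamiltonian, heisenbergHamiltonian]
  congr 1
  refine sum_congr rfl fun e _ => ?_
  induction e using Sym2.ind with
  | h x y =>
    simp only [Sym2.lift_mk, spinDotSym_mk, spinDot, Fin.sum_univ_three, Complex.ofReal_one, one_smul]

/-- **vi) (2.17) at the isotropic point: `[H_XXZ(J,1), S^j_tot] = 0` for all `j`** (`SU(2)` invariance of the
Heisenberg model). [cite: KomaTasaki1993, (2.17), §1] [cite: Tasaki2020, §2.5 eq. (2.5.2)] -/
theorem commute_xxzHamiltonian_one_totalSpin (G : SimpleGraph Λ) [DecidableRel G.Adj] (J : ℝ) (j : Fin 3) :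
    Commute (xxzHamiltonian n G J 1) (totalSpin n j) := by
  rw [xxzHamiltonian_one_eq_heisenberg]
  exact commute_heisenbergHamiltonian_totalSpin n G J j

end Graph

/-! ### §2. The torus: the antiferromagnetic `ℤ₂` and `SU(2)` systems -/

section Torus

variable (d L n : ℕ) [NeZero L]

/-- The sublattice parity exponent `Σ_i x_i` (canonical representatives) of a torus site; on the even
torus `(-1)^{Σ_i x_i}` is the Néel sign. [cite: KomaTasaki1993, §1 (1.2)] [cite: DLS1978, §1] -/
def torusParityExp (x : TorusSite d L) : ℕ := ∑ i, (x i).val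

/-- Re-indexing the staggered spin by `Fin |Λ|`. [cite: KomaTasaki1993, §2 (2.14)] -/
theorem sum_equivFin_stagSign_smul_siteSpin (k : Fin 3) :
    ∑ i, ((stagSign (torusParityExp d L) ((Fintype.equivFin (TorusSite d L)).symm i) : ℂ) •
        siteSpin n ((Fintype.equivFin (TorusSite d L)).symm i) k : Op (TorusSite d L) (n + 1)) =
      stagSpin n (torusParityExp d L) k :=
  (Fintype.equivFin (TorusSite d L)).symm.sum_comp (fun y =>
    ((stagSign (torusParityExp d L) y : ℂ) • siteSpin n y k : Op (TorusSite d L) (n + 1)))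

/-- **THE XXZ ANTIFERROMAGNET ON THE TORUS AS A KOMA–TASAKI `ℤ₂` SYSTEM WITH STAGGERED ORDER** (KT93 §1, §2):
`h_x` the halved XXZ bonds out of `x`, `o_x = (-1)^xSˣ_x` (`O_Λ = Σ_x(-1)^xSˣ_x`, (1.2)), `U_Λ` the half
turn about the `3`-axis, `S(x)` the closed neighbourhood (`r = 2d+2`), `h̄ = hbar`, `ō = s`.
[cite: KomaTasaki1993, §1 (1.1)–(1.2), §2 (2.1)–(2.9), ii), iii)] -/
def afZ2System (J Δ : ℝ) :
    KomaTasaki.Z2System (Fintype.card (TorusSite d L)) (hbar d n J Δ) (sNorm n) (2 * d + 2)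
      (TorusSite d L → Fin (n + 1)) where
  h i := localHam n (torusGraph d L) J Δ ((Fintype.equivFin (TorusSite d L)).symm i)
  o i := (stagSign (torusParityExp d L) ((Fintype.equivFin (TorusSite d L)).symm i) : ℂ) •
    siteSpin n ((Fintype.equivFin (TorusSite d L)).symm i) 0
  U := halfTurn n
  supp i := (nbhd d L ((Fintype.equivFin (TorusSite d L)).symm i)).map (Fintype.equivFin (TorusSite d L)).toEmbedding
  isHermitian_h i := isHermitian_localHam n _ J Δ _
  isHermitian_o i := isHermitian_stagSign_smul_siteSpin n _ _ 0
  U_mul_conjTranspose := halfTurn_mul_conjTranspose n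
  conj_hamiltonian := by
    rw [(Fintype.equivFin (TorusSite d L)).symm.sum_comp (fun y => localHam n (torusGraph d L) J Δ y), sum_localHam,
      halfTurn_conj_xxzHamiltonian]
  conj_order := by
    rw [sum_equivFin_stagSign_smul_siteSpin]
    exact halfTurn_conj_stagSpin_zero n (torusParityExp d L)
  norm_h_le i := norm_localHam_le d L n J Δ _
  norm_o_le i := norm_stagSign_smul_siteSpin_le n _ _ 0
  commute_h_o i j hj := by
    have hj' : (Fintype.equivFin (TorusSite d L)).symm j ∉ nbhd d L ((Fintype.equivFin (TorusSite d L)).symm i) := by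
      rwa [Finset.mem_map_equiv] at hj
    have hne : (Fintype.equivFin (TorusSite d L)).symm j ≠ (Fintype.equivFin (TorusSite d L)).symm i := fun h =>
      hj' (h ▸ Finset.mem_insert_self _ _)
    have hadj : ¬ (torusGraph d L).Adj ((Fintype.equivFin (TorusSite d L)).symm i)
        ((Fintype.equivFin (TorusSite d L)).symm j) := fun h =>
      hj' (Finset.mem_insert_of_mem (Finset.mem_filter.2 ⟨Finset.mem_univ _, h⟩))
    exact commute_localHam_stagSign_smul_siteSpin n _ (torusGraph d L) J Δ hne hadj 0
  card_supp_le i := by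
    rw [Finset.card_map]
    exact (card_nbhd_le d L _).trans (by omega)
  two_le_r := by omega

/-- **THE HEISENBERG ANTIFERROMAGNET ON THE TORUS AS A KOMA–TASAKI `SU(2)` SYSTEM** (KT93 §2 (2.14)–(2.17),
i)–vi), for its own model §1): `h_x` the halved bonds of `xxzHamiltonian n (torusGraph d L) J 1 = J Σ 𝐒_x·𝐒_y`,
`o^{(i)}_x = (-1)^xS^i_x` (2.14), `X^{(j)} = S^j_tot` (2.15), v) (2.16), vi) (2.17), iv), `U_Λ` the half turn
about the `3`-axis flipping `O^{(1)} = Σ_x(-1)^xSˣ_x`. [cite: KomaTasaki1993, §1, §2 (2.14)–(2.17), i)–vi)] -/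
def afSU2System (J : ℝ) :
    KomaTasaki.SU2System (Fintype.card (TorusSite d L)) (hbar d n J 1) (sNorm n) (2 * d + 2)
      (TorusSite d L → Fin (n + 1)) where
  h i := localHam n (torusGraph d L) J 1 ((Fintype.equivFin (TorusSite d L)).symm i)
  o k i := (stagSign (torusParityExp d L) ((Fintype.equivFin (TorusSite d L)).symm i) : ℂ) •
    siteSpin n ((Fintype.equivFin (TorusSite d L)).symm i) k
  X j := totalSpin n j
  U := halfTurn n
  supp _ i := (nbhd d L ((Fintype.equivFin (TorusSite d L)).symm i)).map (Fintype.equivFin (TorusSite d L)).toEmbedding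
  isHermitian_h i := isHermitian_localHam n _ J 1 _
  isHermitian_o k i := isHermitian_stagSign_smul_siteSpin n _ _ k
  isHermitian_X j := totalSpin_isHermitian n j
  U_mul_conjTranspose := halfTurn_mul_conjTranspose n
  conj_hamiltonian := by
    rw [(Fintype.equivFin (TorusSite d L)).symm.sum_comp (fun y => localHam n (torusGraph d L) J 1 y), sum_localHam,
      halfTurn_conj_xxzHamiltonian]
  conj_order := by
    rw [sum_equivFin_stagSign_smul_siteSpin]
    exact halfTurn_conj_stagSpin_zero n (torusParityExp d L)
  norm_h_le i := norm_localHam_le d L n J 1 _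
  norm_o_le k i := norm_stagSign_smul_siteSpin_le n _ _ k
  commute_h_o k i j hj := by
    have hj' : (Fintype.equivFin (TorusSite d L)).symm j ∉ nbhd d L ((Fintype.equivFin (TorusSite d L)).symm i) := by
      rwa [Finset.mem_map_equiv] at hj
    have hne : (Fintype.equivFin (TorusSite d L)).symm j ≠ (Fintype.equivFin (TorusSite d L)).symm i := fun h =>
      hj' (h ▸ Finset.mem_insert_self _ _)
    have hadj : ¬ (torusGraph d L).Adj ((Fintype.equivFin (TorusSite d L)).symm i)
        ((Fintype.equivFin (TorusSite d L)).symm j) := fun h =>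
      hj' (Finset.mem_insert_of_mem (Finset.mem_filter.2 ⟨Finset.mem_univ _, h⟩))
    exact commute_localHam_stagSign_smul_siteSpin n _ (torusGraph d L) J 1 hne hadj k
  card_supp_le _ i := by
    rw [Finset.card_map]
    exact (card_nbhd_le d L _).trans (by omega)
  two_le_r := by omega
  commute_o_o k k' i j hij :=
    commute_stagSign_smul_siteSpin n _
      (fun h => hij ((Fintype.equivFin (TorusSite d L)).symm.injective h)) k k'
  X_comm j k := totalSpin_comm_totalSpin n j k
  X_order j k := by
    simp only [sum_equivFin_stagSign_smul_siteSpin]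
    exact totalSpin_comm_stagSpin n (torusParityExp d L) j k
  commute_hamiltonian_X j := by
    rw [(Fintype.equivFin (TorusSite d L)).symm.sum_comp (fun y => localHam n (torusGraph d L) J 1 y), sum_localHam]
    exact commute_xxzHamiltonian_one_totalSpin n (torusGraph d L) J j

/-! #### Dictionary -/

/-- `H_Λ = xxzHamiltonian n (torusGraph d L) J Δ`. [cite: KomaTasaki1993, §2 (2.2)] -/
theorem afZ2System_hamiltonian (J Δ : ℝ) :
    (afZ2System d L n J Δ).hamiltonian = xxzHamiltonian n (torusGraph d L) J Δ := by
  rw [KomaTasaki.Z2System.hamiltonian]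
  change ∑ i, localHam n (torusGraph d L) J Δ ((Fintype.equivFin (TorusSite d L)).symm i) = _
  rw [(Fintype.equivFin (TorusSite d L)).symm.sum_comp (fun y => localHam n (torusGraph d L) J Δ y), sum_localHam]

/-- `O_Λ = Σ_x(-1)^xSˣ_x`. [cite: KomaTasaki1993, §1 (1.2), §2 (2.4)] -/
theorem afZ2System_order (J Δ : ℝ) :
    (afZ2System d L n J Δ).order = (stagSpin n (torusParityExp d L) 0 : Op (TorusSite d L) (n + 1)) := by
  rw [KomaTasaki.Z2System.order]
  change ∑ i, ((stagSign (torusParityExp d L) ((Fintype.equivFin (TorusSite d L)).symm i) : ℂ) •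
    siteSpin n ((Fintype.equivFin (TorusSite d L)).symm i) 0 : Op (TorusSite d L) (n + 1)) = _
  rw [sum_equivFin_stagSign_smul_siteSpin]

/-- The `SU(2)` system's underlying `ℤ₂` system is `afZ2System d L n J 1`. [cite: KomaTasaki1993, Cor 2.2] -/
theorem afSU2System_toZ2System (J : ℝ) : (afSU2System d L n J).toZ2System = afZ2System d L n J 1 := rfl

/-- `m_Λ(B) = |Λ|⁻¹ Re⟨O_Λ⟩_{β, H - B·O_Λ}` (staggered magnetisation under the staggered field `B`, (1.4)).
[cite: KomaTasaki1993, §1 (1.3)–(1.4), §2 (2.9)] -/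
theorem afZ2System_magnetisation (J Δ β B : ℝ) :
    (afZ2System d L n J Δ).magnetisation β B =
      (Fintype.card (TorusSite d L) : ℝ)⁻¹ *
        (gibbsState β (xxzHamiltonian n (torusGraph d L) J Δ - (B : ℂ) • stagSpin n (torusParityExp d L) 0)
          (stagSpin n (torusParityExp d L) 0)).re := by
  rw [KomaTasaki.Z2System.magnetisation, KomaTasaki.Z2System.fieldHamiltonian, afZ2System_hamiltonian,
    afZ2System_order]

/-- `|Λ| = L^d`. [folklore] -/
private theorem card_torusSite' : Fintype.card (TorusSite d L) = L ^ d := by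
  rw [Fintype.card_pi, prod_const, ZMod.card, card_univ, Fintype.card_fin]

/-- **`N⁻²⟨O_Λ²⟩_Λ(0) = |Λ|⁻² Σ_{x,y} (-1)^x(-1)^y Re⟨Sˣ_xSˣ_y⟩_β`** — the symmetric second moment is the
STAGGERED long-range order quantity (1.7) of `gibbsXXZCorrTorus 0`. [cite: KomaTasaki1993, §1 (1.7), §2 (2.12)] -/
theorem afZ2System_moment_one (J Δ β : ℝ) :
    (afZ2System d L n J Δ).moment β 1 =
      (∑ x : TorusSite d L, ∑ y : TorusSite d L,
          (-1 : ℝ) ^ (∑ i, (x i).val) * (-1) ^ (∑ i, (y i).val) * gibbsXXZCorrTorus 0 (d := d) β L n J Δ x y) /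
        (Fintype.card (TorusSite d L) : ℝ) ^ 2 := by
  rw [KomaTasaki.Z2System.moment, afZ2System_hamiltonian, afZ2System_order, mul_one, div_eq_inv_mul]
  congr 1
  rw [pow_two, stagSpin, Finset.sum_mul_sum, map_sum, Complex.re_sum]
  refine Finset.sum_congr rfl fun x _ => ?_
  rw [map_sum, Complex.re_sum]
  refine Finset.sum_congr rfl fun y _ => ?_
  rw [Matrix.smul_mul, Matrix.mul_smul, smul_smul, LinearMap.map_smul, smul_eq_mul, ← Complex.ofReal_mul,
    Complex.re_ofReal_mul, gibbsXXZCorrTorus_of_neZero, stagSign, stagSign, torusParityExp, torusParityExp]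

end Torus

/-! ### §3. Spontaneous staggered magnetisation at `T > 0`, `d ≥ 3` -/

section Thermal

variable {d : ℕ}

/-- `|Λ_{2k+2}| = (2k+2)^d → ∞`. [cite: KomaTasaki1993, §2 (|Λ| → ∞)] -/
theorem tendsto_card_torusSite_two_mul_add_two (hd : 1 ≤ d) :
    Tendsto (fun k : ℕ => Fintype.card (TorusSite d (2 * k + 2))) atTop atTop := by
  have h : (fun k : ℕ => Fintype.card (TorusSite d (2 * k + 2))) = fun k => (2 * k + 2) ^ d :=
    funext fun k => card_torusSite' d (2 * k + 2)
  have h2 : Tendsto (fun k : ℕ => 2 * k + 2) atTop atTop :=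
    Filter.tendsto_atTop_atTop.2 fun b => ⟨b, fun k hk => by omega⟩
  rw [h]
  exact (tendsto_pow_atTop (by omega)).comp h2

/-- From `HasStaggeredEvenTorusLRO` of `gibbsXXZCorrTorus 0` to an eventual floor on the symmetric second
moments of the staggered order operator: `σ² ≤ N⁻²⟨O_Λ²⟩_Λ(0)` on all large even tori, some `σ > 0`.
[cite: KomaTasaki1993, §1 (1.7), §2 (2.12)] [cite: DLS1978, §1] -/
theorem exists_sq_le_afMoment_of_hasStaggeredEvenTorusLRO {n : ℕ} {J Δ β : ℝ}
    (h : HasStaggeredEvenTorusLRO (fun L x y => gibbsXXZCorrTorus 0 (d := d) β L n J Δ x y)) :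
    ∃ σ : ℝ, 0 < σ ∧ ∀ᶠ k : ℕ in atTop, σ ^ 2 ≤ (afZ2System d (2 * k + 2) n J Δ).moment β 1 := by
  rw [hasStaggeredEvenTorusLRO_iff_holds] at h
  obtain ⟨f, hf, hpos⟩ : ∃ f : ℕ → ℝ, (∀ k, f k =
      (∑ x : TorusSite d (2 * k + 2), ∑ y : TorusSite d (2 * k + 2),
          (-1 : ℝ) ^ (∑ i, (x i).val) * (-1) ^ (∑ i, (y i).val) *
            gibbsXXZCorrTorus 0 (d := d) β (2 * k + 2) n J Δ x y) / ((2 * k + 2 : ℕ) : ℝ) ^ (2 * d)) ∧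
      0 < liminf f atTop := ⟨_, fun _ => rfl, h⟩
  have hmom : ∀ k : ℕ, f k = (afZ2System d (2 * k + 2) n J Δ).moment β 1 := fun k => by
    rw [hf, afZ2System_moment_one, card_torusSite', Nat.cast_pow, ← pow_mul, mul_comm d 2]
  have hnonneg : ∀ k : ℕ, 0 ≤ f k := fun k => by
    rw [hmom]
    exact KomaTasaki.Z2System.moment_nonneg _ β 1
  have hcl : liminf f atTop / 2 < liminf f atTop := half_lt_self hpos
  have hev := eventually_lt_of_lt_liminf hcl (isBoundedUnder_of ⟨0, fun k => hnonneg k⟩)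
  refine ⟨Real.sqrt (liminf f atTop / 2), Real.sqrt_pos.2 (half_pos hpos), hev.mono fun k hk => ?_⟩
  rw [Real.sq_sqrt (half_pos hpos).le, ← hmom]
  exact hk.le

/-- **ENGINE, `U(1)` (XXZ on the even tori, any `J, Δ`, every `β > 0`).**  Staggered long-range order of `Sˣ` in
the symmetric Gibbs states forces, for some `σ > 0` and every staggered field `B > 0`, `ε > 0`, eventually on the
even tori `(ℤ/(2k+2)ℤ)^d`: `√2 σ - ε ≤ |Λ|⁻¹ Re⟨O_Λ⟩_{β, H - B·O_Λ}`, `O_Λ = Σ_x(-1)^xSˣ_x` — KT93 Theorem 2.1 with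
the `U(1)` factor `√2` (generator `Sᶻ_tot`, second component `Σ(-1)^xSʸ_x`), hypothesis i) removed.
[cite: KomaTasaki1993, Theorem 2.1 (2.13), Corollary 2.2 with Remark after Theorem 6.1, §1 (1.4)–(1.8)] -/
theorem af_thermal_stagMagnetisation_ge_sqrt_two_of_LRO (hd : 1 ≤ d) {n : ℕ} {J Δ β : ℝ} (hβ : 0 < β)
    (h : HasStaggeredEvenTorusLRO (fun L x y => gibbsXXZCorrTorus 0 (d := d) β L n J Δ x y)) :
    ∃ σ : ℝ, 0 < σ ∧ ∀ B : ℝ, 0 < B → ∀ ε : ℝ, 0 < ε → ∀ᶠ k : ℕ in atTop,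
      Real.sqrt 2 * σ - ε ≤ (Fintype.card (TorusSite d (2 * k + 2)) : ℝ)⁻¹ *
        (gibbsState β (xxzHamiltonian n (torusGraph d (2 * k + 2)) J Δ -
            (B : ℂ) • stagSpin n (torusParityExp d (2 * k + 2)) 0)
          (stagSpin n (torusParityExp d (2 * k + 2)) 0)).re := by
  obtain ⟨σ, hσ, hLRO⟩ := exists_sq_le_afMoment_of_hasStaggeredEvenTorusLRO h
  refine ⟨σ, hσ, fun B hB ε hε => ?_⟩
  have hev := KomaTasaki.Z2System.le_sqrt_two_mul_magnetisation_add_of_eventually_moment_one_u1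
    (fun k => afZ2System d (2 * k + 2) n J Δ) (fun k => stagSpin n (torusParityExp d (2 * k + 2)) 1)
    (fun _ => totalSpin n 2) (neg_ne_zero.2 Complex.I_ne_zero) zero_le_one
    (fun k => isHermitian_stagSpin n (torusParityExp d (2 * k + 2)) 1)
    (fun k => by
      rw [afZ2System_hamiltonian]
      exact HardCoreBoson.commute_xxzHamiltonian_totalSpin_two n _ J Δ)
    (fun k => by
      rw [afZ2System_order]
      exact totalSpin_two_comm_stagSpin_one n _)
    (fun k => by
      rw [afZ2System_order]
      exact totalSpin_two_comm_stagSpin_zero n _)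
    (fun k => norm_stagSpin_le n _ 1)
    (fun k => by
      rw [afZ2System_order]
      exact norm_stagSpin_one_comm_stagSpin_zero_le n _)
    (zero_le_one.trans (one_le_sNorm n)) hβ (tendsto_card_torusSite_two_mul_add_two hd)
    (fun k => log_card_config_le d (2 * k + 2) n) hσ.le hLRO hB hε
  filter_upwards [hev] with k hk
  rw [afZ2System_magnetisation] at hk
  linarith

/-- **ENGINE, `SU(2)` (Heisenberg antiferromagnet `Δ = 1` on the even tori, any `J`, every `β > 0`).**  Staggered
long-range order of `Sˣ` in the symmetric Gibbs states forces, for some `σ > 0` and every staggered field `B > 0`,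
`ε > 0`, eventually on the even tori: `√3 σ - ε ≤ |Λ|⁻¹ Re⟨O_Λ⟩_{β, H - B·O_Λ}` — KT93 Corollary 2.2 (2.18),
hypothesis i) removed (`SU2System.le_sqrt_three_mul_magnetisation_add_of_eventually_moment_one`).
[cite: KomaTasaki1993, Corollary 2.2 (2.18), §1 (1.8)] -/
theorem af_thermal_stagMagnetisation_ge_sqrt_three_of_LRO (hd : 1 ≤ d) {n : ℕ} {J β : ℝ} (hβ : 0 < β)
    (h : HasStaggeredEvenTorusLRO (fun L x y => gibbsXXZCorrTorus 0 (d := d) β L n J 1 x y)) :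
    ∃ σ : ℝ, 0 < σ ∧ ∀ B : ℝ, 0 < B → ∀ ε : ℝ, 0 < ε → ∀ᶠ k : ℕ in atTop,
      Real.sqrt 3 * σ - ε ≤ (Fintype.card (TorusSite d (2 * k + 2)) : ℝ)⁻¹ *
        (gibbsState β (xxzHamiltonian n (torusGraph d (2 * k + 2)) J 1 -
            (B : ℂ) • stagSpin n (torusParityExp d (2 * k + 2)) 0)
          (stagSpin n (torusParityExp d (2 * k + 2)) 0)).re := by
  obtain ⟨σ, hσ, hLRO⟩ := exists_sq_le_afMoment_of_hasStaggeredEvenTorusLRO h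
  refine ⟨σ, hσ, fun B hB ε hε => ?_⟩
  have hev := KomaTasaki.SU2System.le_sqrt_three_mul_magnetisation_add_of_eventually_moment_one
    (fun k => afSU2System d (2 * k + 2) n J) (zero_le_one.trans (one_le_sNorm n)) hβ
    (tendsto_card_torusSite_two_mul_add_two hd) (fun k => log_card_config_le d (2 * k + 2) n) hσ.le
    (by simpa only [afSU2System_toZ2System] using hLRO) hB hε
  filter_upwards [hev] with k hk
  rw [afSU2System_toZ2System, afZ2System_magnetisation] at hk
  linarith

/-- **SYMMETRY BREAKING IN THE HEISENBERG ANTIFERROMAGNET AT `T > 0`, `d ≥ 3` (KT93 Corollary 2.2 FOR ITS OWN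
MODEL, BY NAME, hypothesis i) removed).**  For `d ≥ 3`, every spin `S = n/2 ≥ ½` and `J > 0` there is `β₀ > 0`
such that for every `β ≥ β₀` there is `σ > 0` (a Néel long-range order of the symmetric Gibbs states at `β`,
Dyson–Lieb–Simon / Kennedy–Lieb–Shastry / Björnberg–Ueltschi) with: for every staggered field `B > 0` and every
`ε > 0`, eventually on the even tori `(ℤ/(2k+2)ℤ)^d`,
**`√3 σ - ε ≤ |Λ|⁻¹ Re⟨O_Λ⟩_{β, H - B·O_Λ}`**, `H = J Σ_{⟨x,y⟩}𝐒_x·𝐒_y` (`xxzHamiltonian n (torusGraph d (2k+2)) J 1`),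
`O_Λ = Σ_x(-1)^xSˣ_x`.  Hence `liminf_Λ m_Λ(B) ≥ √3 σ` for every `B > 0` and the spontaneous staggered
magnetisation (1.6) satisfies `m_s ≥ √3 σ` along every convergent choice of the limits (1.5).
[cite: KomaTasaki1993, §1 (1.1)–(1.8), Corollary 2.2 (2.18)] [cite: DLS1978, §1–§2]
[cite: BjornbergUeltschi2022, Theorem 3.2] -/
theorem heisenbergAF_thermal_spontaneousStaggeredMagnetisation (hd : 3 ≤ d) {n : ℕ} (hn : 1 ≤ n) {J : ℝ}
    (hJ : 0 < J) :
    ∃ β₀ : ℝ, 0 < β₀ ∧ ∀ β : ℝ, β₀ ≤ β → ∃ σ : ℝ, 0 < σ ∧ ∀ B : ℝ, 0 < B → ∀ ε : ℝ, 0 < ε →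
      ∀ᶠ k : ℕ in atTop,
        Real.sqrt 3 * σ - ε ≤ (Fintype.card (TorusSite d (2 * k + 2)) : ℝ)⁻¹ *
          (gibbsState β (xxzHamiltonian n (torusGraph d (2 * k + 2)) J 1 -
              (B : ℂ) • stagSpin n (torusParityExp d (2 * k + 2)) 0)
            (stagSpin n (torusParityExp d (2 * k + 2)) 0)).re := by
  obtain ⟨β₀, hβ₀, hlro⟩ := xxzAF_thermal_planar_x hd hn hJ zero_le_one le_rfl
  exact ⟨β₀, hβ₀, fun β hβ =>
    af_thermal_stagMagnetisation_ge_sqrt_three_of_LRO (by omega) (lt_of_lt_of_le hβ₀ hβ) (hlro β hβ)⟩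

/-- **XXZ ANTIFERROMAGNET WITH XY-LIKE ANISOTROPY (`0 ≤ Δ ≤ 1`, `U(1)`): SPONTANEOUS STAGGERED MAGNETISATION
`≥ √2 σ` AT `T > 0`, `d ≥ 3`** (KT93 Theorem 2.1 / Remark after Theorem 6.1 BY NAME, hypothesis i) removed).
For `d ≥ 3`, `S = n/2 ≥ ½`, `J > 0`, `0 ≤ Δ ≤ 1`: there is `β₀ > 0` such that for every `β ≥ β₀` there is `σ > 0`
with: for every staggered field `B > 0` and `ε > 0`, eventually on the even tori,
**`√2 σ - ε ≤ |Λ|⁻¹ Re⟨O_Λ⟩_{β, H - B·O_Λ}`**, `H = xxzHamiltonian n (torusGraph d (2k+2)) J Δ`, `O_Λ = Σ_x(-1)^xSˣ_x`.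
[cite: KomaTasaki1993, Theorem 2.1 (2.13), Remark after Theorem 6.1, §1 (1.4)–(1.8)]
[cite: BjornbergUeltschi2022, Theorem 3.2] [cite: DLS1978, §1–§2] -/
theorem xxzAF_thermal_spontaneousStaggeredMagnetisation (hd : 3 ≤ d) {n : ℕ} (hn : 1 ≤ n) {J : ℝ} (hJ : 0 < J)
    {Δ : ℝ} (hΔ : 0 ≤ Δ) (hΔ' : Δ ≤ 1) :
    ∃ β₀ : ℝ, 0 < β₀ ∧ ∀ β : ℝ, β₀ ≤ β → ∃ σ : ℝ, 0 < σ ∧ ∀ B : ℝ, 0 < B → ∀ ε : ℝ, 0 < ε →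
      ∀ᶠ k : ℕ in atTop,
        Real.sqrt 2 * σ - ε ≤ (Fintype.card (TorusSite d (2 * k + 2)) : ℝ)⁻¹ *
          (gibbsState β (xxzHamiltonian n (torusGraph d (2 * k + 2)) J Δ -
              (B : ℂ) • stagSpin n (torusParityExp d (2 * k + 2)) 0)
            (stagSpin n (torusParityExp d (2 * k + 2)) 0)).re := by
  obtain ⟨β₀, hβ₀, hlro⟩ := xxzAF_thermal_planar_x hd hn hJ hΔ hΔ'
  exact ⟨β₀, hβ₀, fun β hβ =>
    af_thermal_stagMagnetisation_ge_sqrt_two_of_LRO (by omega) (lt_of_lt_of_le hβ₀ hβ) (hlro β hβ)⟩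

end Thermal

end XXZKT

end Literature.MathematicalPhysics.QuantumLattice
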